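import Literature.AlgebraicTopology.SingularHomology.SingularChainsConcrete
import Literature.AlgebraicTopology.SingularHomology.ChainSubcomplex
import Literature.AlgebraicTopology.SingularHomology.CupProductSupports
import Mathlib.Algebra.DirectSum.Module
import HarnessLib

/-!
# Additivity of singular homology over a clopen partition (arbitrary index set)

A. Hatcher, *Algebraic Topology* (2002), Prop. 2.6: "*Corresponding to the decomposition of a
space `X` into its path-components `X_α` there is an isomorphism of `Hₙ(X)` with the direct sum
`⊕_α Hₙ(X_α)`*" — the proof given there ("a singular simplex always has path-connected image
… so `Cₙ(X)` splits as the direct sum of its subgroups `Cₙ(X_α)`, the boundary maps preserve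
this decomposition, hence so do the homology groups") works verbatim for any decomposition
`X = ⊔ₖ Aₖ` into pairwise disjoint **open** (hence closed) subsets, which is also the additivity
axiom `Hₙ(∐ X_α) ≅ ⊕_α Hₙ(X_α)` of §2.3. The tree has the two-summand case
(`DisjointUnion.lean`, `X ⊕ Y`); this file proves the case of an arbitrary index type, needed for
the sheets of an infinite cyclic cover (`Literature/Topology/FourManifolds/InfiniteCyclicCover.lean`,
Rolfsen (1976) §8.C: `H₁(Ũ) = ⊕_{k ∈ ℤ} H₁(Yₖ)` for the lifts of the cut-open knot complement).

For a clopen partition `IsClopenPartition A` (`A : ι → Set Z` open, pairwise disjoint, covering)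
we prove, for Mathlib's singular homology `Literature.singularHomology R M` with any coefficients:

* `IsClopenPartition.color` — every singular simplex lies in exactly one piece (its image is
  preconnected), and faces stay in the same piece;
* `csingularChainComplex.pieceRetraction` — the chain map `C(Z) → C(↥(A k))` discarding the
  simplices outside `A k` (a retraction of the inclusion: `incl♯ ≫ retraction = 𝟙`, and `= 0` on
  the other pieces); every chain is the (finite) sum of the push-forwards of its retractions
  (`sum_mapDomain_pieceRetr`);
* `singularHomology.pieceSum_bijective`, **`singularHomology.clopenPartitionEquiv`** —
  `(⨁ₖ Hₙ(↥(A k); M)) ≃ₗ[R] Hₙ(Z; M)`, `(xₖ)ₖ ↦ ∑ₖ (inclₖ)_* xₖ` (Hatcher Prop. 2.6), with the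
  element-level corollaries `map_subsetIncl_injective_of_isClopenPartition` (each `(inclₖ)_*` is
  injective), `eq_zero_of_sum_map_subsetIncl_eq_zero` (independence of the pieces) and
  `exists_eq_sum_map_subsetIncl` (every class is a finite sum over the pieces).

Everything is proved at chain level in the concrete model `Literature.AlgebraicTopology.SingularHomology.csingularChainComplex`
(`SingularChainsConcrete.lean`) and transported along `csingularHomology.compIso`; no named fact
is introduced.

## References

* A. Hatcher, *Algebraic Topology*, CUP (2002), Prop. 2.6, §2.3 (additivity axiom). [Hatcher2002]

## Design notes

* The partition is a `Prop`-valued structure on a family of sets rather than a continuous map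
  to a discrete space; `IsClopenPartition.ofContinuous` builds it from such a map (fibres).
* The retraction is *not* induced by a continuous map; it is the `Finsupp.comapDomain` of the
  (injective) push-forward of simplices along the inclusion, assembled into a chain map by hand
  (faces of a simplex lie in the piece of the simplex).
-/

noncomputable section

-- as in `SingularChainsConcrete`: chains of the concrete complex are `Finsupp`s up to unfolding
set_option backward.isDefEq.respectTransparency false

open CategoryTheory Limits Set Function
open scoped DirectSum

universe u v w

namespace Literature.AlgebraicTopology.SingularHomology

variable (R : Type v) [CommRing R] (M : Type v) [AddCommGroup M] [Module R M]
variable {Z : Type u} [TopologicalSpace Z] {ι : Type w}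

/-! ### Clopen partitions -/

/-- A **clopen partition** of `Z` indexed by `ι`: open, pairwise disjoint subsets covering `Z`
(each piece is then also closed). [folklore] -/
structure IsClopenPartition (A : ι → Set Z) : Prop where
  /-- every piece is open -/
  isOpen : ∀ k, IsOpen (A k)
  /-- distinct pieces are disjoint -/
  disjoint : ∀ ⦃j k⦄, j ≠ k → Disjoint (A j) (A k)
  /-- the pieces cover -/
  exists_mem : ∀ z, ∃ k, z ∈ A k

namespace IsClopenPartition

/-- The fibres of a continuous map to a discrete space form a clopen partition. [folklore] -/
theorem ofContinuous {D : Type w} [TopologicalSpace D] [DiscreteTopology D] (c : C(Z, D)) :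
    IsClopenPartition fun k : D => c ⁻¹' {k} where
  isOpen k := (isOpen_discrete {k}).preimage c.continuous
  disjoint _ _ hjk := Set.disjoint_iff.2 fun _ ⟨hj, hk⟩ => hjk (hj.symm.trans hk)
  exists_mem z := ⟨c z, rfl⟩

variable {A : ι → Set Z} (h : IsClopenPartition A)
include h

/-- A point lies in only one piece. [folklore] -/
theorem eq_of_mem {j k : ι} {z : Z} (hj : z ∈ A j) (hk : z ∈ A k) : j = k := by
  by_contra hjk
  exact Set.disjoint_left.1 (h.disjoint hjk) hj hk

/-- **A preconnected set meeting a piece lies in it** (the piece and the union of the other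
pieces are disjoint open sets covering the set). [folklore] -/
theorem subset_of_isPreconnected {s : Set Z} (hs : IsPreconnected s) {k : ι} {z : Z} (hz : z ∈ s)
    (hk : z ∈ A k) : s ⊆ A k := by
  refine hs.subset_left_of_subset_union (h.isOpen k) (isOpen_biUnion fun j (_ : j ≠ k) => h.isOpen j)
    ?_ ?_ ⟨z, hz, hk⟩
  · exact Set.disjoint_left.2 fun x hx hx' => by
      obtain ⟨j, hj, hxj⟩ := Set.mem_iUnion₂.1 hx'
      exact hj (h.eq_of_mem hxj hx)
  · intro x _
    obtain ⟨j, hj⟩ := h.exists_mem x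
    by_cases hjk : j = k
    · exact Or.inl (hjk ▸ hj)
    · exact Or.inr (Set.mem_iUnion₂.2 ⟨j, hjk, hj⟩)

/-! ### The piece of a singular simplex -/

variable {n : ℕ}

/-- **Every singular simplex lies in one piece** (its image is preconnected; Hatcher 2002,
Prop. 2.6). [cite: Hatcher2002, Prop. 2.6] -/
theorem exists_range_subset (σ : SingularSimplex Z n) : ∃ k, σ.range ⊆ A k := by
  obtain ⟨z, hz⟩ := σ.range_nonempty
  obtain ⟨k, hk⟩ := h.exists_mem z
  exact ⟨k, h.subset_of_isPreconnected
    (isPreconnected_range (SingularSimplex.toContinuousMap σ).continuous) hz hk⟩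

/-- The index of the piece containing the simplex `σ`. [folklore] -/
def color (σ : SingularSimplex Z n) : ι := (h.exists_range_subset σ).choose

/-- The simplex lies in its piece. [folklore] -/
theorem range_subset_color (σ : SingularSimplex Z n) : σ.range ⊆ A (h.color σ) :=
  (h.exists_range_subset σ).choose_spec

/-- The piece of a simplex is characterised by containing it. [folklore] -/
theorem color_eq_iff {σ : SingularSimplex Z n} {k : ι} : h.color σ = k ↔ σ.range ⊆ A k := by
  constructor
  · rintro rfl
    exact h.range_subset_color σ
  · intro hk
    obtain ⟨z, hz⟩ := σ.range_nonempty
    exact h.eq_of_mem (h.range_subset_color σ hz) (hk hz)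

/-- A simplex outside the piece `A k` has another colour. [folklore] -/
theorem not_range_subset_iff {σ : SingularSimplex Z n} {k : ι} : ¬ σ.range ⊆ A k ↔ h.color σ ≠ k := by
  rw [Ne, h.color_eq_iff]

/-- Faces stay in the piece. [folklore] -/
theorem color_face (i : Fin (n + 2)) (σ : SingularSimplex Z (n + 1)) :
    h.color (σ.face i) = h.color σ :=
  h.color_eq_iff.2 ((SingularSimplex.range_face_subset i σ).trans (h.range_subset_color σ))

/-- A simplex of the subspace `A k`, included into `Z`, has colour `k`. [folklore] -/
theorem color_map_subsetIncl (k : ι) (τ : SingularSimplex (A k) n) :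
    h.color (τ.map (subsetIncl (A k))) = k :=
  h.color_eq_iff.2 (SingularSimplex.range_map_val_subset (A k) τ)

end IsClopenPartition

/-! ### Restriction of chains to a subspace -/

namespace csingularChainComplex

open SingularSimplex

variable {R M} {n : ℕ}

/-- **Restriction of chains to a subspace**: the `R`-linear map `Cₙ(Z; M) → Cₙ(↥A; M)` keeping the
simplices with image in `A` (as simplices of `A`) and discarding the others; the
`Finsupp.comapDomain` of the injective push-forward of simplices along `A ↪ Z`. [folklore] -/
def pieceRetr (A : Set Z) (n : ℕ) : CChain M Z n →ₗ[R] CChain M A n :=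
  Finsupp.lcomapDomain (fun τ : SingularSimplex A n => τ.map (subsetIncl A))
    (map_injective Subtype.val_injective)

/-- `pieceRetr` applied to a chain, evaluated at a simplex of `A`. [folklore] -/
theorem pieceRetr_apply (A : Set Z) (c : CChain M Z n) (τ : SingularSimplex A n) :
    pieceRetr (R := R) A n c τ = c (τ.map (subsetIncl A)) := rfl

/-- `pieceRetr` on the push-forward of a simplex of `A`. [folklore] -/
@[simp]
theorem pieceRetr_single_map (A : Set Z) (τ : SingularSimplex A n) (m : M) :
    pieceRetr (R := R) A n (Finsupp.single (τ.map (subsetIncl A)) m) = Finsupp.single τ m :=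
  Finsupp.comapDomain_single _ _ _ _

/-- `pieceRetr` kills the simplices not inside `A`. [folklore] -/
theorem pieceRetr_single_of_not_subset (A : Set Z) {σ : SingularSimplex Z n} (hσ : ¬ σ.range ⊆ A)
    (m : M) : pieceRetr (R := R) A n (Finsupp.single σ m) = 0 := by
  refine Finsupp.comapDomain_single_of_not_mem_range (fun ⟨τ, hτ⟩ => hσ ?_) m _
  rw [← hτ]
  exact range_map_val_subset A τ

/-- `pieceRetr` on a simplex inside `A` is the restricted simplex. [folklore] -/
theorem pieceRetr_single_of_subset (A : Set Z) {σ : SingularSimplex Z n} (hσ : σ.range ⊆ A) (m : M) :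
    pieceRetr (R := R) A n (Finsupp.single σ m) = Finsupp.single (σ.codRestrict A hσ) m := by
  conv_lhs => rw [← codRestrict_map_val σ A hσ]
  exact pieceRetr_single_map A _ m

/-- `pieceRetr` is a retraction of the push-forward `Cₙ(↥A) → Cₙ(Z)`. [folklore] -/
@[simp]
theorem pieceRetr_mapDomain (A : Set Z) (c : CChain M A n) :
    pieceRetr (R := R) A n (Finsupp.mapDomain (fun τ : SingularSimplex A n => τ.map (subsetIncl A)) c) =
      c :=
  Finsupp.comapDomain_mapDomain _ (map_injective Subtype.val_injective) c

/-! ### The retraction chain map onto a piece of a clopen partition -/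

variable {A : ι → Set Z} (h : IsClopenPartition A)
include h

/-- For a clopen partition, restriction to a piece commutes with the boundary (faces of a simplex
lie in the piece of the simplex; Hatcher 2002, proof of Prop. 2.6). [cite: Hatcher2002, Prop. 2.6] -/
theorem pieceRetr_bd (k : ι) (c : CChain M Z (n + 1)) :
    pieceRetr (R := R) (A k) n (bd R n c) = bd R n (pieceRetr (R := R) (A k) (n + 1) c) := by
  induction c using Finsupp.induction_linear with
  | zero => simp
  | add c₁ c₂ h₁ h₂ => rw [map_add, map_add, map_add, map_add, h₁, h₂]
  | single σ m =>
    rw [bd_single, map_sum]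
    by_cases hσ : σ.range ⊆ A k
    · rw [pieceRetr_single_of_subset (A k) hσ, bd_single]
      refine Finset.sum_congr rfl fun i _ => ?_
      rw [map_smul, pieceRetr_single_of_subset (A k) ((range_face_subset i σ).trans hσ),
        codRestrict_face]
    · rw [pieceRetr_single_of_not_subset (A k) hσ, map_zero]
      refine Finset.sum_eq_zero fun i _ => ?_
      have hi : ¬ (σ.face i).range ⊆ A k := by
        rw [h.not_range_subset_iff] at hσ ⊢
        rwa [h.color_face]
      rw [map_smul, pieceRetr_single_of_not_subset (A k) hi, smul_zero]

/-- **The retraction chain map `C(Z; M) ⟶ C(↥(A k); M)` onto the `k`-th piece of a clopen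
partition** (Hatcher 2002, proof of Prop. 2.6: the boundary preserves the decomposition of
chains by pieces). [cite: Hatcher2002, Prop. 2.6] -/
def pieceRetraction (k : ι) : csingularChainComplex R M Z ⟶ csingularChainComplex R M (A k) where
  f n := ModuleCat.ofHom (pieceRetr (R := R) (A k) n)
  comm' i j hij := by
    have hij' : j + 1 = i := hij
    subst hij'
    rw [d_eq, d_eq]
    ext c
    change bd R j (pieceRetr (R := R) (A k) (j + 1) c) = pieceRetr (R := R) (A k) j (bd R j c)
    rw [pieceRetr_bd h]

/-- The retraction chain map degreewise. [folklore] -/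
@[simp]
theorem pieceRetraction_f_apply (k : ι) (n : ℕ) (c : (csingularChainComplex R M Z).X n) :
    (pieceRetraction (R := R) (M := M) h k).f n c = pieceRetr (R := R) (A k) n c := rfl

/-- `inclₖ♯ ≫ retractionₖ = 𝟙`. [folklore] -/
theorem map_subsetIncl_comp_pieceRetraction (k : ι) :
    map R M (subsetIncl (A k)) ≫ pieceRetraction (R := R) (M := M) h k = 𝟙 _ := by
  ext n c
  change pieceRetr (R := R) (A k) n ((map R M (subsetIncl (A k))).f n c) = c
  rw [map_f_apply, pieceRetr_mapDomain]

/-- `inclⱼ♯ ≫ retractionₖ = 0` for `j ≠ k` (the pieces are disjoint). [folklore] -/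
theorem map_subsetIncl_comp_pieceRetraction_of_ne {j k : ι} (hjk : j ≠ k) :
    map R M (subsetIncl (A j)) ≫ pieceRetraction (R := R) (M := M) h k = 0 := by
  ext n c
  change pieceRetr (R := R) (A k) n ((map R M (subsetIncl (A j))).f n c) = 0
  induction c using Finsupp.induction_linear with
  | zero => simp
  | add c₁ c₂ h₁ h₂ => rw [map_add, map_add, h₁, h₂, add_zero]
  | single τ m =>
    rw [map_f_single, pieceRetr_single_of_not_subset]
    rw [h.not_range_subset_iff, h.color_map_subsetIncl]
    exact hjk

/-- **A chain is the sum of the push-forwards of its restrictions to the pieces**, over any finite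
set of indices containing the colours of its simplices. [folklore] -/
theorem sum_mapDomain_pieceRetr (c : CChain M Z n) (S : Finset ι)
    (hS : ∀ σ ∈ c.support, h.color σ ∈ S) :
    ∑ k ∈ S, Finsupp.mapDomain (fun τ : SingularSimplex (A k) n => τ.map (subsetIncl (A k)))
      (pieceRetr (R := R) (A k) n c) = c := by
  classical
  induction c using Finsupp.induction with
  | zero => simp
  | single_add σ m c hσc hm ih =>
    have hσS : h.color σ ∈ S := hS σ (by
      rw [Finsupp.mem_support_iff, Finsupp.add_apply, Finsupp.single_eq_same,
        Finsupp.notMem_support_iff.1 hσc, add_zero]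
      exact hm)
    have hcS : ∀ σ' ∈ c.support, h.color σ' ∈ S := fun σ' hσ' => hS σ' (by
      have hne : ¬ σ = σ' := fun e => hσc (e ▸ hσ')
      rw [Finsupp.mem_support_iff, Finsupp.add_apply, Finsupp.single_apply, if_neg hne, zero_add]
      exact Finsupp.mem_support_iff.1 hσ')
    simp only [map_add, Finsupp.mapDomain_add, Finset.sum_add_distrib, ih hcS]
    congr 1
    rw [Finset.sum_eq_single_of_mem (h.color σ) hσS]
    · rw [pieceRetr_single_of_subset (A (h.color σ)) (h.range_subset_color σ),
        Finsupp.mapDomain_single, codRestrict_map_val]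
    · intro k _ hk
      rw [pieceRetr_single_of_not_subset (A k) (h.not_range_subset_iff.2 (Ne.symm hk)),
        Finsupp.mapDomain_zero]

/-- The colours of the simplices of a chain form a finite set. [folklore] -/
theorem exists_finset_color (c : CChain M Z n) : ∃ S : Finset ι, ∀ σ ∈ c.support, h.color σ ∈ S := by
  classical
  exact ⟨c.support.image h.color, fun σ hσ => Finset.mem_image_of_mem _ hσ⟩

/-- The retraction chain map degreewise (restated without the partition hypothesis in scope for
rewriting). [folklore] -/
theorem pieceRetraction_f (k : ι) (n : ℕ) :
    (pieceRetraction (R := R) (M := M) h k).f n = ModuleCat.ofHom (pieceRetr (R := R) (A k) n) := rfl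

end csingularChainComplex

/-! ### Additivity on homology: the concrete model -/

namespace csingularHomology

open csingularChainComplex

variable {R M} {A : ι → Set Z} (h : IsClopenPartition A)
include h

/-- The retraction `Hₙ(Z) → Hₙ(↥(A k))` on concrete homology. [folklore] -/
def pieceProj (k : ι) (n : ℕ) : csingularHomology R M Z n ⟶ csingularHomology R M (A k) n :=
  HomologicalComplex.homologyMap (pieceRetraction (R := R) (M := M) h k) n

/-- `(inclₖ)_* ≫ projₖ = 𝟙` on concrete homology. [folklore] -/
theorem map_comp_pieceProj (k : ι) (n : ℕ) :
    map R M (subsetIncl (A k)) n ≫ pieceProj h k n = 𝟙 _ := by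
  rw [map, pieceProj, ← HomologicalComplex.homologyMap_comp, map_subsetIncl_comp_pieceRetraction,
    HomologicalComplex.homologyMap_id]

/-- `(inclⱼ)_* ≫ projₖ = 0` for `j ≠ k` on concrete homology. [folklore] -/
theorem map_comp_pieceProj_of_ne {j k : ι} (hjk : j ≠ k) (n : ℕ) :
    map R M (subsetIncl (A j)) n ≫ pieceProj h k n = 0 := by
  rw [map, pieceProj, ← HomologicalComplex.homologyMap_comp,
    map_subsetIncl_comp_pieceRetraction_of_ne h hjk, HomologicalComplex.homologyMap_zero]

/-- **Every class of `Hₙ(Z)` (concrete model) is a finite sum of push-forwards from the pieces.**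
[cite: Hatcher2002, Prop. 2.6] -/
theorem exists_eq_sum_map (n : ℕ) (y : csingularHomology R M Z n) :
    ∃ (S : Finset ι) (x : ∀ k, csingularHomology R M (A k) n),
      y = ∑ k ∈ S, map R M (subsetIncl (A k)) n (x k) := by
  obtain ⟨z, hz, rfl⟩ := homologyCls_surjective y
  obtain ⟨S, hS⟩ := exists_finset_color h z
  have hzk : ∀ k, (csingularChainComplex R M (A k)).d n ((ComplexShape.down ℕ).next n)
      (pieceRetr (R := R) (A k) n z) = 0 := fun k =>
    d_hom_f_eq_zero (pieceRetraction (R := R) (M := M) h k) z hz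
  refine ⟨S, fun k => homologyCls (pieceRetr (R := R) (A k) n z) (hzk k), ?_⟩
  have hsum : ∀ k, map R M (subsetIncl (A k)) n (homologyCls (pieceRetr (R := R) (A k) n z) (hzk k)) =
      homologyCls ((csingularChainComplex.map R M (subsetIncl (A k))).f n (pieceRetr (R := R) (A k) n z))
        (d_hom_f_eq_zero _ _ (hzk k)) := fun k =>
    homologyMap_homologyCls _ _ _
  simp only [hsum]
  symm
  -- the sum of the classes is the class of the sum, which is `z`
  have key : ∀ T : Finset ι, ∑ k ∈ T, homologyCls
      ((csingularChainComplex.map R M (subsetIncl (A k))).f n (pieceRetr (R := R) (A k) n z))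
        (d_hom_f_eq_zero _ _ (hzk k)) =
      homologyCls (∑ k ∈ T, (csingularChainComplex.map R M (subsetIncl (A k))).f n
        (pieceRetr (R := R) (A k) n z)) (by
          rw [map_sum]; exact Finset.sum_eq_zero fun k _ => d_hom_f_eq_zero _ _ (hzk k)) := by
    classical
    intro T
    induction T using Finset.induction_on with
    | empty => simp [homologyCls_zero]
    | insert k T hkT ih =>
      rw [Finset.sum_insert hkT, ih, ← homologyCls_add _ _ _ _ (by
        rw [map_add, d_hom_f_eq_zero _ _ (hzk k), zero_add, map_sum]
        exact Finset.sum_eq_zero fun j _ => d_hom_f_eq_zero _ _ (hzk j))]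
      exact homologyCls_congr (by rw [Finset.sum_insert hkT]) _ _
  rw [key S]
  exact homologyCls_congr (by
    simp only [map_f_apply]
    exact sum_mapDomain_pieceRetr (R := R) h z S hS) _ _

/-- **If a finite sum of push-forwards from the pieces vanishes in `Hₙ(Z)` (concrete model), every
term vanishes.** [cite: Hatcher2002, Prop. 2.6] -/
theorem eq_zero_of_sum_map_eq_zero (n : ℕ) (S : Finset ι) (x : ∀ k, csingularHomology R M (A k) n)
    (hx : ∑ k ∈ S, map R M (subsetIncl (A k)) n (x k) = 0) (k : ι) (hk : k ∈ S) : x k = 0 := by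
  classical
  have hproj := congrArg (pieceProj (R := R) (M := M) h k n) hx
  rw [map_sum, map_zero, Finset.sum_eq_single_of_mem k hk] at hproj
  · rwa [← ModuleCat.comp_apply, map_comp_pieceProj, ModuleCat.id_apply] at hproj
  · intro j _ hjk
    rw [← ModuleCat.comp_apply, map_comp_pieceProj_of_ne h hjk]
    rfl

end csingularHomology

/-! ### Additivity on homology: Mathlib's singular homology -/

namespace singularHomology

variable {R M} {A : ι → Set Z}

/-- Mathlib's `f_*` in terms of the concrete one: `f_* (comp a) = comp (f_* a)`. [folklore] -/
theorem map_compIso_hom_apply {Y : Type u} [TopologicalSpace Y] (f : C(Y, Z)) (n : ℕ)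
    (a : csingularHomology R M Y n) :
    singularHomology.map R M f n ((csingularHomology.compIso R M Y n).hom a) =
      (csingularHomology.compIso R M Z n).hom (csingularHomology.map R M f n a) := by
  rw [← ModuleCat.comp_apply, ← csingularHomology.map_comp_compIso_hom, ModuleCat.comp_apply]

variable (h : IsClopenPartition A)
include h

/-- **Every class of `Hₙ(Z; M)` is a finite sum of push-forwards from the pieces of a clopen
partition** (Hatcher 2002, Prop. 2.6). [cite: Hatcher2002, Prop. 2.6] -/
theorem exists_eq_sum_map_subsetIncl (n : ℕ) (y : singularHomology R M Z n) :
    ∃ (S : Finset ι) (x : ∀ k, singularHomology R M (A k) n),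
      y = ∑ k ∈ S, singularHomology.map R M (subsetIncl (A k)) n (x k) := by
  obtain ⟨y', rfl⟩ := (ModuleCat.epi_iff_surjective _).mp
    (inferInstance : Epi (csingularHomology.compIso R M Z n).hom) y
  obtain ⟨S, x, rfl⟩ := csingularHomology.exists_eq_sum_map (R := R) h n y'
  refine ⟨S, fun k => (csingularHomology.compIso R M (A k) n).hom (x k), ?_⟩
  simp only [map_sum, map_compIso_hom_apply]

/-- **Independence of the pieces**: if a finite sum of push-forwards from the pieces of a clopen
partition vanishes in `Hₙ(Z; M)`, every term vanishes (Hatcher 2002, Prop. 2.6).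
[cite: Hatcher2002, Prop. 2.6] -/
theorem eq_zero_of_sum_map_subsetIncl_eq_zero (n : ℕ) (S : Finset ι)
    (x : ∀ k, singularHomology R M (A k) n)
    (hx : ∑ k ∈ S, singularHomology.map R M (subsetIncl (A k)) n (x k) = 0) (k : ι) (hk : k ∈ S) :
    x k = 0 := by
  have hsurj : ∀ j, ∃ x' : csingularHomology R M (A j) n, (csingularHomology.compIso R M (A j) n).hom x' = x j :=
    fun j => (ModuleCat.epi_iff_surjective _).mp
      (inferInstance : Epi (csingularHomology.compIso R M (A j) n).hom) (x j)
  choose x' hx' using hsurj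
  have hx0 : ∑ j ∈ S, csingularHomology.map R M (subsetIncl (A j)) n (x' j) = 0 := by
    apply (ModuleCat.mono_iff_injective _).mp
      (inferInstance : Mono (csingularHomology.compIso R M Z n).hom)
    rw [map_sum, map_zero]
    simp only [← map_compIso_hom_apply, hx']
    exact hx
  have := csingularHomology.eq_zero_of_sum_map_eq_zero (R := R) h n S x' hx0 k hk
  rw [← hx' k, this, map_zero]

/-- **`(inclₖ)_* : Hₙ(↥(A k); M) → Hₙ(Z; M)` is injective** for every piece of a clopen partition.
[cite: Hatcher2002, Prop. 2.6] -/
theorem map_subsetIncl_injective_of_isClopenPartition (k : ι) (n : ℕ) :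
    Injective (singularHomology.map R M (subsetIncl (A k)) n) := by
  classical
  rw [injective_iff_map_eq_zero]
  intro a ha
  have := eq_zero_of_sum_map_subsetIncl_eq_zero (R := R) (M := M) h n {k}
    (fun j => if hj : j = k then hj ▸ a else 0) ?_ k (Finset.mem_singleton_self k)
  · simpa using this
  · rw [Finset.sum_singleton]
    simpa using ha

section DirectSum

variable [DecidableEq ι]

omit h in
/-- **The additivity map** `(⨁ₖ Hₙ(↥(A k); M)) →ₗ[R] Hₙ(Z; M)`, `(xₖ)ₖ ↦ ∑ₖ (inclₖ)_* xₖ`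
(Hatcher 2002, Prop. 2.6). [cite: Hatcher2002, Prop. 2.6] -/
def pieceSum (A : ι → Set Z) (n : ℕ) :
    (⨁ k, singularHomology R M (A k) n) →ₗ[R] singularHomology R M Z n :=
  DirectSum.toModule R ι _ fun k => (singularHomology.map R M (subsetIncl (A k)) n).hom

omit h in
/-- `pieceSum` on a single component is the push-forward. [folklore] -/
@[simp]
theorem pieceSum_lof (n : ℕ) (k : ι) (x : singularHomology R M (A k) n) :
    pieceSum (R := R) (M := M) A n (DirectSum.lof R ι _ k x) =
      singularHomology.map R M (subsetIncl (A k)) n x := by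
  rw [pieceSum, DirectSum.toModule_lof]

omit h in
/-- `pieceSum` as a finite sum over the support. [folklore] -/
theorem pieceSum_eq_sum (n : ℕ) [∀ (k : ι) (y : singularHomology R M (A k) n), Decidable (y ≠ 0)]
    (x : ⨁ k, singularHomology R M (A k) n) :
    pieceSum (R := R) (M := M) A n x =
      ∑ k ∈ x.support, singularHomology.map R M (subsetIncl (A k)) n (x k) := by
  conv_lhs => rw [← DirectSum.sum_support_of x]
  rw [map_sum]
  refine Finset.sum_congr rfl fun k _ => ?_
  exact pieceSum_lof (R := R) (M := M) n k (x k)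

/-- **Additivity of singular homology over a clopen partition**: `(xₖ)ₖ ↦ ∑ₖ (inclₖ)_* xₖ` is
bijective (Hatcher 2002, Prop. 2.6; §2.3, additivity axiom). [cite: Hatcher2002, Prop. 2.6] -/
theorem pieceSum_bijective (n : ℕ) : Bijective (pieceSum (R := R) (M := M) A n) := by
  classical
  constructor
  · rw [injective_iff_map_eq_zero]
    intro x hx
    rw [pieceSum_eq_sum] at hx
    refine DFinsupp.ext fun k => ?_
    by_cases hk : k ∈ x.support
    · exact eq_zero_of_sum_map_subsetIncl_eq_zero (R := R) (M := M) h n x.support (fun j => x j) hx k hk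
    · simpa using hk
  · intro y
    obtain ⟨S, x, rfl⟩ := exists_eq_sum_map_subsetIncl (R := R) (M := M) h n y
    refine ⟨∑ k ∈ S, DirectSum.lof R ι _ k (x k), ?_⟩
    rw [map_sum]
    exact Finset.sum_congr rfl fun k _ => pieceSum_lof (R := R) (M := M) n k (x k)

/-- **`(⨁ₖ Hₙ(↥(A k); M)) ≃ₗ[R] Hₙ(Z; M)`** for a clopen partition `Z = ⊔ₖ A k`
(Hatcher 2002, Prop. 2.6: `Hₙ(X) ≅ ⊕_α Hₙ(X_α)`; §2.3, additivity axiom).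
[cite: Hatcher2002, Prop. 2.6] -/
def clopenPartitionEquiv (n : ℕ) : (⨁ k, singularHomology R M (A k) n) ≃ₗ[R] singularHomology R M Z n :=
  LinearEquiv.ofBijective (pieceSum (R := R) (M := M) A n) (pieceSum_bijective h n)

/-- The equivalence on a single component is the push-forward. [folklore] -/
@[simp]
theorem clopenPartitionEquiv_lof (n : ℕ) (k : ι) (x : singularHomology R M (A k) n) :
    clopenPartitionEquiv (R := R) (M := M) h n (DirectSum.lof R ι _ k x) =
      singularHomology.map R M (subsetIncl (A k)) n x :=
  pieceSum_lof (R := R) (M := M) n k x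

end DirectSum

end singularHomology

end Literature.AlgebraicTopology.SingularHomology
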